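import Summits.ValiantsHypothesis.ValiantsHypothesis.Theorems.LacunarySymmetroidMatrixDescartesCensusDoorA34HollowCornerSplit

/-!
# `MatrixDescartes` census — DOOR A at `(3,4)`: a net congruent to an ISOTROPIC hollow-corner net (`ε₁ε₂ = 0`) has a degenerate
# annihilator pencil (double root) — the isotropic chart classes lie on the discriminant hypersurface

HONEST FRAMING.  Object-search cell `pub-symmetroid`, door-A seat `val-sym-door-p3` (g18); item stmt-ValiantsHypothesis-19980
`DoorA34 = PosRootLawAt 3 4 18` is OPEN and asserted nowhere in this file.  The main theorem is an EQUIVALENCE between the door and an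
explicit family of fewnomial rows, which is NOT bounded here.  Nothing bounds `ζ_sym(3,4)`; nothing bears on `MatrixDescartes`
(stmt-ValiantsHypothesis-18050) or on `VP ≠ VNP`.

CONTENT (all supports; no `def`, no `sorry`).  `…HollowCornerSplit` proved
`DoorA34 ↔ ∀ d ε₁ ε₂ u w α β, εᵢ ∈ {1,0,−1} → Z₊(∑ X^{d_l}[[ε₁u_l+ε₂w_l,α_l,β_l],[α_l,u_l,0],[β_l,0,w_l]]) ≤ 18` — nine sign classes,
five of them ISOTROPIC (`ε₁ε₂ = 0`).  This file supplies the algebra that removes them (the companion `…HollowCornerSigned` concludes):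
* §18 generic LINEAR INDEPENDENCE of the four letters: the coordinate determinant `Ψ = det (X_{l,00}, X_{l,11}, X_{l,22}, X_{l,01})_l`
  (`coordDet_witness`, `letters_independent_of_coordDet_ne_zero`) and `exists_symm_witness_mul` (two polynomials with symmetric
  non-vanishing points have a common one — symmetric tuples off a hypersurface are dense, `DenseRows.exists_symm_near_eval_ne_zero`);
* §19 **`false_of_isotropic_hollowCorner_congr`**: if four INDEPENDENT symmetric letters are congruent to a hollow-corner net with
  `ε₁ε₂ = 0`, then NO pair of symmetric annihilators `B₁, B₂` has `det B₁ ≠ 0` and non-zero discriminant of `x ↦ det(B₂ − xB₁)`: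
  the annihilator pencil of such a net is `{[[s,0,0],[0,−ε₁s,t],[0,t,−ε₂s]]}` with cubic `−(s₂ − xs₁)(t₂ − xt₁)²` — a DOUBLE ROOT —
  so neither branch of `annihilator_dichotomy` (three distinct real roots / a unique SIMPLE real root) can hold;
[folklore] Pencils of conics / Cayley's four-nodal cubic symmetroid; elementary linear algebra.
-/

-- `Summit.ValiantsHypothesis.ValiantsHypothesis.…` repeats a component by the D-0017 layout
-- (single-conjunct summit), which the `dupNamespace` linter flags; the name is mandated.
set_option linter.dupNamespace false

namespace Summit.ValiantsHypothesis.ValiantsHypothesis.Theorems.LacunarySymmetroidMatrixDescartes.Census.EqualDiagonal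

open Matrix Finset
open scoped BigOperators

/-! ## 18. Generic linear independence of the four letters -/

section Independence

/-- If the `4 × 4` coordinate matrix `(S_l 00, S_l 11, S_l 22, S_l 01)_l` of four `3 × 3` letters is non-singular, the letters are
linearly independent. [folklore] -/
theorem letters_independent_of_coordDet_ne_zero (S : Fin 4 → Matrix (Fin 3) (Fin 3) ℝ)
    (hdet : (Matrix.of fun l k => (![S l 0 0, S l 1 1, S l 2 2, S l 0 1] : Fin 4 → ℝ) k).det ≠ 0)
    (c : Fin 4 → ℝ) (hc : ∑ l, c l • S l = 0) : c = 0 := by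
  classical
  by_contra hne
  apply hdet
  refine Matrix.exists_vecMul_eq_zero_iff.mp ⟨c, hne, ?_⟩
  have hentry : ∀ i j, ∑ l, c l * S l i j = 0 := by
    intro i j
    have h := congrFun (congrFun hc i) j
    simpa [Matrix.sum_apply, Matrix.smul_apply] using h
  funext k
  simp only [Matrix.vecMul, dotProduct, Matrix.of_apply, Pi.zero_apply]
  fin_cases k
  · simpa using hentry 0 0
  · simpa using hentry 1 1
  · simpa using hentry 2 2
  · simpa using hentry 0 1

/-- **The coordinate determinant as a polynomial in the `36` entry variables**, its evaluation, and a symmetric witness: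
`Ψ = det (X_{l,0,0}, X_{l,1,1}, X_{l,2,2}, X_{l,0,1})_l` has `Ψ(E₀₀, E₁₁, E₂₂, E₀₁ + E₁₀) = 1`. [folklore] -/
theorem coordDet_witness :
    ∃ Ψ : MvPolynomial (Fin 4 × Fin 3 × Fin 3) ℝ,
      (∃ S₀ : Fin 4 → Matrix (Fin 3) (Fin 3) ℝ, (∀ l, (S₀ l).IsSymm) ∧
        MvPolynomial.eval (fun idx : Fin 4 × Fin 3 × Fin 3 => S₀ idx.1 idx.2.1 idx.2.2) Ψ ≠ 0) ∧
      ∀ S : Fin 4 → Matrix (Fin 3) (Fin 3) ℝ,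
        MvPolynomial.eval (fun idx : Fin 4 × Fin 3 × Fin 3 => S idx.1 idx.2.1 idx.2.2) Ψ
          = (Matrix.of fun l k => (![S l 0 0, S l 1 1, S l 2 2, S l 0 1] : Fin 4 → ℝ) k).det := by
  classical
  let AX : Matrix (Fin 4) (Fin 4) (MvPolynomial (Fin 4 × Fin 3 × Fin 3) ℝ) :=
    Matrix.of fun l k => (![MvPolynomial.X (l, (0 : Fin 3), (0 : Fin 3)), MvPolynomial.X (l, (1 : Fin 3), (1 : Fin 3)),
      MvPolynomial.X (l, (2 : Fin 3), (2 : Fin 3)), MvPolynomial.X (l, (0 : Fin 3), (1 : Fin 3))] : Fin 4 → _) k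
  have key : ∀ S : Fin 4 → Matrix (Fin 3) (Fin 3) ℝ,
      MvPolynomial.eval (fun idx : Fin 4 × Fin 3 × Fin 3 => S idx.1 idx.2.1 idx.2.2) AX.det
        = (Matrix.of fun l k => (![S l 0 0, S l 1 1, S l 2 2, S l 0 1] : Fin 4 → ℝ) k).det := by
    intro S
    rw [RingHom.map_det]
    congr 1
    ext l k
    fin_cases k <;> simp [AX, RingHom.mapMatrix_apply, Matrix.map_apply, MvPolynomial.eval_X]
  refine ⟨AX.det, ?_, key⟩
  set S₀ : Fin 4 → Matrix (Fin 3) (Fin 3) ℝ :=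
    ![!![1, 0, 0; 0, 0, 0; 0, 0, 0], !![0, 0, 0; 0, 1, 0; 0, 0, 0], !![0, 0, 0; 0, 0, 0; 0, 0, 1],
      !![0, 1, 0; 1, 0, 0; 0, 0, 0]] with hS₀
  refine ⟨S₀, fun l => ?_, ?_⟩
  · refine Matrix.IsSymm.ext fun i j => ?_
    fin_cases l <;> fin_cases i <;> fin_cases j <;> simp [hS₀]
  · rw [key S₀]
    have hA : (Matrix.of fun l k => (![S₀ l 0 0, S₀ l 1 1, S₀ l 2 2, S₀ l 0 1] : Fin 4 → ℝ) k) = 1 := by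
      ext l k
      fin_cases l <;> fin_cases k <;> simp [hS₀]
    rw [hA, Matrix.det_one]
    exact one_ne_zero

/-- **Two generic conditions have a common symmetric witness.**  If `Φ` and `Ψ` each do not vanish at some symmetric tuple, then `Φ·Ψ`
does not vanish at some symmetric tuple (symmetric tuples off `{Φ = 0}` are dense among symmetric tuples). [folklore] -/
theorem exists_symm_witness_mul (Φ Ψ : MvPolynomial (Fin 4 × Fin 3 × Fin 3) ℝ)
    (hΦ : ∃ S₀ : Fin 4 → Matrix (Fin 3) (Fin 3) ℝ, (∀ l, (S₀ l).IsSymm) ∧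
      MvPolynomial.eval (fun idx : Fin 4 × Fin 3 × Fin 3 => S₀ idx.1 idx.2.1 idx.2.2) Φ ≠ 0)
    (hΨ : ∃ S₀ : Fin 4 → Matrix (Fin 3) (Fin 3) ℝ, (∀ l, (S₀ l).IsSymm) ∧
      MvPolynomial.eval (fun idx : Fin 4 × Fin 3 × Fin 3 => S₀ idx.1 idx.2.1 idx.2.2) Ψ ≠ 0) :
    ∃ S₀ : Fin 4 → Matrix (Fin 3) (Fin 3) ℝ, (∀ l, (S₀ l).IsSymm) ∧
      MvPolynomial.eval (fun idx : Fin 4 × Fin 3 × Fin 3 => S₀ idx.1 idx.2.1 idx.2.2) (Φ * Ψ) ≠ 0 := by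
  obtain ⟨S₁, hS₁, hΨ₁⟩ := hΨ
  set U : Set (Fin 4 → Matrix (Fin 3) (Fin 3) ℝ) :=
    {S | MvPolynomial.eval (fun idx : Fin 4 × Fin 3 × Fin 3 => S idx.1 idx.2.1 idx.2.2) Ψ ≠ 0} with hU
  have hcont : Continuous fun S : Fin 4 → Matrix (Fin 3) (Fin 3) ℝ =>
      MvPolynomial.eval (fun idx : Fin 4 × Fin 3 × Fin 3 => S idx.1 idx.2.1 idx.2.2) Ψ := by
    refine (MvPolynomial.continuous_eval Ψ).comp ?_
    refine continuous_pi fun idx => ?_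
    exact ((continuous_apply idx.2.2).comp ((continuous_apply idx.2.1).comp (continuous_apply idx.1)))
  have hUopen : IsOpen U := isOpen_ne_fun hcont continuous_const
  obtain ⟨S', hS'U, hS'symm, hS'Φ⟩ := DenseRows.exists_symm_near_eval_ne_zero Φ hΦ S₁ hS₁ U hUopen hΨ₁
  exact ⟨S', hS'symm, by rw [map_mul]; exact mul_ne_zero hS'Φ hS'U⟩

end Independence

/-! ## 19. A net congruent to an ISOTROPIC hollow-corner net has a degenerate annihilator pencil -/

section Isotropic

/-- Trace of a matrix against a hollow-corner letter. [folklore] -/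
theorem trace_mul_hollowCorner (B : Matrix (Fin 3) (Fin 3) ℝ) (e u w α β : ℝ) :
    (B * !![e, α, β; α, u, 0; β, 0, w]).trace = B 0 0 * e + (B 0 1 + B 1 0) * α + (B 0 2 + B 2 0) * β + B 1 1 * u + B 2 2 * w := by
  rw [Matrix.trace_fin_three]
  simp [Matrix.mul_apply, Fin.sum_univ_three]
  ring

/-- Transport of an annihilator through a congruence: if `S = Pᵀ H P` and `tr(B S) = 0` then `tr((P B Pᵀ) H) = 0`. [folklore] -/
theorem trace_congr_annihilator (B P H : Matrix (Fin 3) (Fin 3) ℝ) :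
    (P * B * Pᵀ * H).trace = (B * (Pᵀ * H * P)).trace := by
  calc (P * B * Pᵀ * H).trace = (P * (B * Pᵀ * H)).trace := by simp only [Matrix.mul_assoc]
    _ = ((B * Pᵀ * H) * P).trace := Matrix.trace_mul_comm _ _
    _ = (B * (Pᵀ * H * P)).trace := by simp only [Matrix.mul_assoc]

/-- Determinant of the special annihilator shape `[[a,0,0],[0,b,c],[0,c,e]]`. [folklore] -/
theorem det_blockShape (a b c e : ℝ) : (!![a, 0, 0; 0, b, c; 0, c, e] : Matrix (Fin 3) (Fin 3) ℝ).det = a * (b * e - c ^ 2) := by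
  rw [Matrix.det_fin_three]
  simp
  ring

/-- **A NET CONGRUENT TO AN ISOTROPIC HOLLOW-CORNER NET HAS A DEGENERATE ANNIHILATOR PENCIL.**  Let four LINEARLY INDEPENDENT real
`3 × 3` letters be congruent, by one invertible `P`, to hollow-corner letters `[[ε₁u_l + ε₂w_l, α_l, β_l], [α_l, u_l, 0], [β_l, 0, w_l]]`
with `ε₁ε₂ = 0` (an isotropic class).  Then there is NO pair of symmetric annihilators `B₁, B₂` (`tr(BᵢS_l) = 0`) with `det B₁ ≠ 0`
and non-zero discriminant of the cubic `x ↦ det(B₂ − xB₁)`.  Reason: transported to the chart, every annihilator is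
`[[s,0,0],[0,−ε₁s,t],[0,t,−ε₂s]]` (independence of the letters makes the annihilator space two-dimensional), so
`det P² · det(B₂ − xB₁) = −(s₂ − xs₁)(t₂ − xt₁)²` has the double root `t₂/t₁`: it cannot have three distinct real roots, and if
its real root is unique then `B₂ = (t₂/t₁)B₁`, contradicting simplicity — the two branches of `annihilator_dichotomy`. [folklore] -/
theorem false_of_isotropic_hollowCorner_congr (S : Fin 4 → Matrix (Fin 3) (Fin 3) ℝ)
    (hind : ∀ c : Fin 4 → ℝ, ∑ l, c l • S l = 0 → c = 0)
    (P : Matrix (Fin 3) (Fin 3) ℝ) (hP : P.det ≠ 0) (ε₁ ε₂ : ℝ) (hε : ε₁ * ε₂ = 0) (u w α β : Fin 4 → ℝ)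
    (hSP : ∀ l, S l = Pᵀ * !![ε₁ * u l + ε₂ * w l, α l, β l; α l, u l, 0; β l, 0, w l] * P)
    (B₁ B₂ : Matrix (Fin 3) (Fin 3) ℝ) (hB₁ : B₁.IsSymm) (hB₂ : B₂.IsSymm) (hdet : B₁.det ≠ 0)
    (hann₁ : ∀ l, (B₁ * S l).trace = 0) (hann₂ : ∀ l, (B₂ * S l).trace = 0)
    (hdisc : (B₁.adjugate * B₂).trace ^ 2 * (-(B₂.adjugate * B₁).trace) ^ 2
        - 4 * (-B₁.det) * (-(B₂.adjugate * B₁).trace) ^ 3 - 4 * (B₁.adjugate * B₂).trace ^ 3 * B₂.det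
        - 27 * (-B₁.det) ^ 2 * B₂.det ^ 2
        + 18 * (-B₁.det) * (B₁.adjugate * B₂).trace * (-(B₂.adjugate * B₁).trace) * B₂.det ≠ 0) :
    False := by
  classical
  -- the chart letters and the coefficient matrix `R` (rows `(u_l, w_l, α_l, β_l)`)
  set H : Fin 4 → Matrix (Fin 3) (Fin 3) ℝ := fun l => !![ε₁ * u l + ε₂ * w l, α l, β l; α l, u l, 0; β l, 0, w l] with hHdef
  set R : Matrix (Fin 4) (Fin 4) ℝ := Matrix.of fun l k => (![u l, w l, α l, β l] : Fin 4 → ℝ) k with hRdef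
  -- (i) independence of the rows of `R`
  have hRdet : R.det ≠ 0 := by
    intro h0
    obtain ⟨c, hcne, hc⟩ := Matrix.exists_vecMul_eq_zero_iff.mpr h0
    have hck : ∀ k, ∑ l, c l * R l k = 0 := fun k => by
      have := congrFun hc k
      simpa [Matrix.vecMul, dotProduct] using this
    have hcu : ∑ l, c l * u l = 0 := by simpa [hRdef] using hck 0
    have hcw : ∑ l, c l * w l = 0 := by simpa [hRdef] using hck 1
    have hcα : ∑ l, c l * α l = 0 := by simpa [hRdef] using hck 2
    have hcβ : ∑ l, c l * β l = 0 := by simpa [hRdef] using hck 3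
    have hH0 : ∑ l, c l • H l = 0 := by
      ext i j
      rw [Matrix.sum_apply]
      simp only [Matrix.smul_apply, smul_eq_mul, Matrix.zero_apply]
      have hce : ∑ l, c l * (ε₁ * u l + ε₂ * w l) = 0 := by
        have : ∑ l, c l * (ε₁ * u l + ε₂ * w l) = ε₁ * ∑ l, c l * u l + ε₂ * ∑ l, c l * w l := by
          rw [Finset.mul_sum, Finset.mul_sum, ← Finset.sum_add_distrib]
          refine Finset.sum_congr rfl fun l _ => by ring
        rw [this, hcu, hcw]; ring
      fin_cases i <;> fin_cases j <;> simp [hHdef, hcu, hcw, hcα, hcβ, hce]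
    have hS0 : ∑ l, c l • S l = 0 := by
      have : ∑ l, c l • S l = Pᵀ * (∑ l, c l • H l) * P := by
        rw [Finset.mul_sum, Finset.sum_mul]
        refine Finset.sum_congr rfl fun l _ => ?_
        rw [hSP l, Matrix.mul_smul, Matrix.smul_mul]
      rw [this, hH0, Matrix.mul_zero, Matrix.zero_mul]
    exact hcne (hind c hS0)
  -- (ii) the shape of a transported annihilator
  have shape : ∀ B : Matrix (Fin 3) (Fin 3) ℝ, B.IsSymm → (∀ l, (B * S l).trace = 0) →
      (P * B * Pᵀ) 1 1 = -ε₁ * (P * B * Pᵀ) 0 0 ∧ (P * B * Pᵀ) 2 2 = -ε₂ * (P * B * Pᵀ) 0 0 ∧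
      (P * B * Pᵀ) 0 1 = 0 ∧ (P * B * Pᵀ) 1 0 = 0 ∧ (P * B * Pᵀ) 0 2 = 0 ∧ (P * B * Pᵀ) 2 0 = 0 ∧
      (P * B * Pᵀ) 2 1 = (P * B * Pᵀ) 1 2 := by
    intro B hB hann
    set Bt : Matrix (Fin 3) (Fin 3) ℝ := P * B * Pᵀ with hBt
    have hBtsymm : ∀ i j, Bt j i = Bt i j := by
      intro i j
      have hT : Btᵀ = Bt := by
        rw [hBt, transpose_mul, transpose_mul, transpose_transpose, hB.eq, ← Matrix.mul_assoc]
      have h := congrFun (congrFun hT i) j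
      rwa [transpose_apply] at h
    have htr : ∀ l, (Bt * H l).trace = 0 := by
      intro l
      rw [hBt, trace_congr_annihilator, ← hSP l]
      exact hann l
    -- the functional `φ` vanishes on the rows of `R`
    set φ : Fin 4 → ℝ := ![ε₁ * Bt 0 0 + Bt 1 1, ε₂ * Bt 0 0 + Bt 2 2, Bt 0 1 + Bt 1 0, Bt 0 2 + Bt 2 0] with hφ
    have hRφ : R *ᵥ φ = 0 := by
      funext l
      have h := htr l
      rw [hHdef] at h
      simp only at h
      rw [trace_mul_hollowCorner] at h
      simp only [Matrix.mulVec, dotProduct, hRdef, hφ, Matrix.of_apply, Pi.zero_apply, Fin.sum_univ_four]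
      simp
      linarith
    have hφ0 : φ = 0 := by
      by_contra hne
      exact hRdet (Matrix.exists_mulVec_eq_zero_iff.mp ⟨φ, hne, hRφ⟩)
    have h0 : ε₁ * Bt 0 0 + Bt 1 1 = 0 := by have := congrFun hφ0 0; simpa [hφ] using this
    have h1 : ε₂ * Bt 0 0 + Bt 2 2 = 0 := by have := congrFun hφ0 1; simpa [hφ] using this
    have h2 : Bt 0 1 + Bt 1 0 = 0 := by have := congrFun hφ0 2; simpa [hφ] using this
    have h3 : Bt 0 2 + Bt 2 0 = 0 := by have := congrFun hφ0 3; simpa [hφ] using this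
    have h10 := hBtsymm 0 1
    have h20 := hBtsymm 0 2
    refine ⟨by linarith, by linarith, by linarith, by linarith, by linarith, by linarith, hBtsymm 1 2⟩
  obtain ⟨h1a, h1b, h1c, h1d, h1e, h1f, h1g⟩ := shape B₁ hB₁ hann₁
  obtain ⟨h2a, h2b, h2c, h2d, h2e, h2f, h2g⟩ := shape B₂ hB₂ hann₂
  set s₁ := (P * B₁ * Pᵀ) 0 0 with hs₁
  set t₁ := (P * B₁ * Pᵀ) 1 2 with ht₁
  set s₂ := (P * B₂ * Pᵀ) 0 0 with hs₂
  set t₂ := (P * B₂ * Pᵀ) 1 2 with ht₂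
  have hBt₁ : P * B₁ * Pᵀ = !![s₁, 0, 0; 0, -ε₁ * s₁, t₁; 0, t₁, -ε₂ * s₁] := by
    ext i j
    fin_cases i <;> fin_cases j <;> simp [h1a, h1b, h1c, h1d, h1e, h1f, h1g, hs₁, ht₁]
  have hBt₂ : P * B₂ * Pᵀ = !![s₂, 0, 0; 0, -ε₁ * s₂, t₂; 0, t₂, -ε₂ * s₂] := by
    ext i j
    fin_cases i <;> fin_cases j <;> simp [h2a, h2b, h2c, h2d, h2e, h2f, h2g, hs₂, ht₂]
  -- (iii) the transported cubic
  have hcubic : ∀ x : ℝ, P.det ^ 2 * (B₂ - x • B₁).det = -((s₂ - x * s₁) * (t₂ - x * t₁) ^ 2) := by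
    intro x
    have hconj : P * (B₂ - x • B₁) * Pᵀ = !![s₂ - x * s₁, 0, 0; 0, -ε₁ * (s₂ - x * s₁), t₂ - x * t₁;
        0, t₂ - x * t₁, -ε₂ * (s₂ - x * s₁)] := by
      rw [Matrix.mul_sub, Matrix.sub_mul, Matrix.mul_smul, Matrix.smul_mul, hBt₁, hBt₂]
      ext i j
      fin_cases i <;> fin_cases j <;> simp <;> ring
    have hd := congrArg Matrix.det hconj
    rw [Matrix.det_mul, Matrix.det_mul, det_transpose, det_blockShape] at hd
    have hε' : -ε₁ * (s₂ - x * s₁) * (-ε₂ * (s₂ - x * s₁)) = 0 := by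
      have : -ε₁ * (s₂ - x * s₁) * (-ε₂ * (s₂ - x * s₁)) = (ε₁ * ε₂) * (s₂ - x * s₁) ^ 2 := by ring
      rw [this, hε, zero_mul]
    rw [hε'] at hd
    calc P.det ^ 2 * (B₂ - x • B₁).det = P.det * (B₂ - x • B₁).det * P.det := by ring
      _ = (s₂ - x * s₁) * (0 - (t₂ - x * t₁) ^ 2) := hd
      _ = -((s₂ - x * s₁) * (t₂ - x * t₁) ^ 2) := by ring
  -- (iv) `det B₁ ≠ 0` forces `s₁ ≠ 0`, `t₁ ≠ 0`
  have hdet₁ : P.det ^ 2 * B₁.det = -(s₁ * t₁ ^ 2) := by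
    have hd := congrArg Matrix.det hBt₁
    rw [Matrix.det_mul, Matrix.det_mul, det_transpose, det_blockShape] at hd
    have hε' : -ε₁ * s₁ * (-ε₂ * s₁) = 0 := by
      have : -ε₁ * s₁ * (-ε₂ * s₁) = (ε₁ * ε₂) * s₁ ^ 2 := by ring
      rw [this, hε, zero_mul]
    rw [hε'] at hd
    calc P.det ^ 2 * B₁.det = P.det * B₁.det * P.det := by ring
      _ = s₁ * (0 - t₁ ^ 2) := hd
      _ = -(s₁ * t₁ ^ 2) := by ring
  have hst : s₁ * t₁ ^ 2 ≠ 0 := by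
    intro h0
    have : P.det ^ 2 * B₁.det = 0 := by rw [hdet₁, h0, neg_zero]
    rcases mul_eq_zero.mp this with h | h
    · exact hP (pow_eq_zero_iff (by norm_num) |>.mp h)
    · exact hdet h
  have hs₁ne : s₁ ≠ 0 := left_ne_zero_of_mul hst
  have ht₁ne : t₁ ≠ 0 := by
    intro h0; apply hst; rw [h0]; ring
  have hP2 : P.det ^ 2 ≠ 0 := pow_ne_zero 2 hP
  -- the two roots `s₂/s₁` and `t₂/t₁`, and every root is one of them
  have hroot_s : (B₂ - (s₂ / s₁) • B₁).det = 0 := by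
    have h := hcubic (s₂ / s₁)
    have hz : s₂ - s₂ / s₁ * s₁ = 0 := by rw [div_mul_cancel₀ s₂ hs₁ne, sub_self]
    rw [hz, zero_mul, neg_zero] at h
    exact (mul_eq_zero.mp h).resolve_left hP2
  have hroot_t : (B₂ - (t₂ / t₁) • B₁).det = 0 := by
    have h := hcubic (t₂ / t₁)
    have hz : t₂ - t₂ / t₁ * t₁ = 0 := by rw [div_mul_cancel₀ t₂ ht₁ne, sub_self]
    rw [hz] at h
    have h' : P.det ^ 2 * (B₂ - (t₂ / t₁) • B₁).det = 0 := by rw [h]; ring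
    exact (mul_eq_zero.mp h').resolve_left hP2
  have hroots : ∀ x : ℝ, (B₂ - x • B₁).det = 0 → x = s₂ / s₁ ∨ x = t₂ / t₁ := by
    intro x hx
    have h := hcubic x
    rw [hx, mul_zero] at h
    have h' : (s₂ - x * s₁) * (t₂ - x * t₁) ^ 2 = 0 := by linarith
    rcases mul_eq_zero.mp h' with h | h
    · left; field_simp; linarith
    · right
      have := pow_eq_zero_iff (by norm_num) |>.mp h
      field_simp; linarith
  -- (v) the dichotomy cannot hold
  rcases annihilator_dichotomy B₁ B₂ hdet hdisc with ⟨μ, hμ, hμroot⟩ | ⟨μ, hμroot, huniq, hsimple⟩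
  · -- three distinct roots inside a two-element set
    have hm : ∀ i, μ i = s₂ / s₁ ∨ μ i = t₂ / t₁ := fun i => hroots (μ i) (hμroot i)
    rcases hm 0 with h0 | h0 <;> rcases hm 1 with h1 | h1 <;> rcases hm 2 with h2 | h2
    all_goals first
      | exact absurd (hμ (h0.trans h1.symm)) (by decide)
      | exact absurd (hμ (h0.trans h2.symm)) (by decide)
      | exact absurd (hμ (h1.trans h2.symm)) (by decide)
  · -- unique root: both quotients equal `μ`, so `B₂ = μ B₁`, contradicting simplicity
    have hsμ : s₂ / s₁ = μ := huniq _ hroot_s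
    have htμ : t₂ / t₁ = μ := huniq _ hroot_t
    have hs₂ : s₂ = μ * s₁ := by rw [← hsμ]; field_simp
    have ht₂ : t₂ = μ * t₁ := by rw [← htμ]; field_simp
    have hconj0 : P * (B₂ - μ • B₁) * Pᵀ = 0 := by
      rw [Matrix.mul_sub, Matrix.sub_mul, Matrix.mul_smul, Matrix.smul_mul, hBt₁, hBt₂, hs₂, ht₂]
      ext i j
      fin_cases i <;> fin_cases j <;> simp <;> ring
    have hPunit : IsUnit P.det := isUnit_iff_ne_zero.mpr hP
    have hPTunit : IsUnit Pᵀ.det := by rw [det_transpose]; exact hPunit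
    have hK0 : B₂ - μ • B₁ = 0 := by
      have h1 : P⁻¹ * (P * (B₂ - μ • B₁) * Pᵀ) * (Pᵀ)⁻¹ = B₂ - μ • B₁ := by
        rw [show P⁻¹ * (P * (B₂ - μ • B₁) * Pᵀ) * (Pᵀ)⁻¹ = (P⁻¹ * P) * (B₂ - μ • B₁) * (Pᵀ * (Pᵀ)⁻¹) by
          simp only [Matrix.mul_assoc]]
        rw [Matrix.nonsing_inv_mul P hPunit, Matrix.mul_nonsing_inv Pᵀ hPTunit, Matrix.one_mul, Matrix.mul_one]
      rw [← h1, hconj0, Matrix.mul_zero, Matrix.zero_mul]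
    apply hsimple
    rw [hK0, Matrix.adjugate_zero, Matrix.zero_mul, Matrix.trace_zero]

end Isotropic

end Summit.ValiantsHypothesis.ValiantsHypothesis.Theorems.LacunarySymmetroidMatrixDescartes.Census.EqualDiagonal
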